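import Summits.HodgeConjecture.HodgeCM.PerL34.S4Strength_1

/-! PORT of `HodgeCM/PerL34/S4Strength.lean` (HodgeCMPerL run 82) — part 2: continuation of `Summits.HodgeConjecture.HodgeCM.PerL34.S4Strength_1` (split at a top-level declaration boundary by port_pkg.py; scope re-opened below; declarations unchanged). -/

-- port_pkg: scope re-opened for this part (file-level context, then the namespace/section stack open at the cut)
set_option autoImplicit false
noncomputable section
namespace HodgeCM
namespace PerL34.ArchC
open HodgeCM.Prior.Perl34File HodgeCM.Prior.Perl34File.Perl34
section Junk
variable {H HG CG G SigIdx SigIdxG : Type*} {SK : Type}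
variable [NormedAddCommGroup H] [InnerProductSpace ℂ H] [CompleteSpace H]
variable [NormedAddCommGroup HG] [InnerProductSpace ℂ HG] [CompleteSpace HG]
variable [NormedAddCommGroup CG] [NormedSpace ℂ CG]
variable [Group G] [TopologicalSpace G] [TopologicalSpace SK]
variable {C : IsolationCore H HG CG G SK SigIdx SigIdxG}
/-- **The junk chart.**  From N21, scalar-closure of the 𝒯-range and ω(1) = id ONLY: `F := ℂ`, `φ⁰ := 1`,
`ιX := ∅` (no Lie-algebra directions: `gen` holds because `ℂ·1 = ℂ`, `inf_invariance`/`Y_mem` are vacuous),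
`Tg := PUnit` with `ιT = 1`, `w = 1`, `ω_T = id` (so `φ₀_eigen` is `1 = 1⁻¹·1` and `omg_ins` is ω(1) = id),
`FinIdx := SK` with `ins Φ c := junkLine Φ c` (so `ins_add/ins_smul` are `add_smul/mul_smul` and `pure_detect` takes
the line through Φ itself at c = 1), `Sm i := σ̂_i` (closed, so trivially dense in itself). -/
def ArchCCore.junk (P : C4a.PointedCore C) (hinv : Invariance C) (hsc : ScalarClosed C) (h1 : OmgOne C) : ArchCCore C P where
  F := ℂ
  ιX := PEmpty
  X := fun k => k.elim
  Tg := PUnit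
  ιT := 1
  w := 1
  w_norm := fun t => by rw [MonoidHom.one_apply, norm_one]
  ωT := fun _ => LinearMap.id
  FinIdx := SK
  ins := fun Φ c => junkLine hsc Φ c
  φ₀ := 1
  Sm := fun i => (C.hatσ i : Set H)
  Y := fun k => k.elim
  ins_add := by
    intro Φ c d
    show C.TΦc (junkLine hsc Φ (c + d)) = C.TΦc (junkLine hsc Φ c) + C.TΦc (junkLine hsc Φ d)
    rw [TΦc_junkLine, TΦc_junkLine, TΦc_junkLine, add_smul]
  ins_smul := by
    intro Φ c d
    show C.TΦc (junkLine hsc Φ (c • d)) = c • C.TΦc (junkLine hsc Φ d)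
    rw [TΦc_junkLine, TΦc_junkLine, smul_eq_mul, mul_smul]
  omg_ins := by
    intro Φ t c
    show C.omg ((1 : PUnit →* G) t) (junkLine hsc Φ c) = junkLine hsc Φ (LinearMap.id c)
    rw [MonoidHom.one_apply, h1, LinearMap.id_apply]
  invariance := hinv
  pure_detect := by
    intro Φ p v h
    refine ⟨Φ, 1, ?_⟩
    show P.evalPt p (C.TΦc (junkLine hsc Φ 1) v) ≠ 0
    rw [TΦc_junkLine, one_smul]
    exact h
  Sm_sub := fun _ => subset_rfl
  Sm_dense := fun _ => subset_closure
  Y_mem := fun k => k.elim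
  inf_invariance := fun _ _ k => k.elim
  gen := by
    intro N h1N _
    rw [Submodule.eq_top_iff']
    intro c
    have hc := N.smul_mem c h1N
    rwa [smul_eq_mul, mul_one] at hc
  φ₀_eigen := by
    intro t
    show (LinearMap.id : ℂ →ₗ[ℂ] ℂ) 1 = ((1 : PUnit →* ℂ) t)⁻¹ • (1 : ℂ)
    rw [LinearMap.id_apply, MonoidHom.one_apply, inv_one, one_smul]

/-- The junk chart's eigen components are exactly the NON-ZERO components (trivial torus, trivial character). -/
theorem ArchCCore.junk_eigen_iff (P : C4a.PointedCore C) (hinv : Invariance C) (hsc : ScalarClosed C) (h1 : OmgOne C) (i : SigIdx) :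
    (ArchCCore.junk P hinv hsc h1).Eigen i ↔ C.hatσ i ≠ ⊥ := by
  rw [Submodule.ne_bot_iff]
  constructor
  · rintro ⟨y, hy, hy0, -⟩
    exact ⟨y, hy, hy0⟩
  · rintro ⟨y, hy, hy0⟩
    refine ⟨y, hy, hy0, fun t => ?_⟩
    show C.R ((1 : PUnit →* G) t) y = (1 : PUnit →* ℂ) t • y
    rw [MonoidHom.one_apply, MonoidHom.one_apply, map_one, one_apply_eq_self, one_smul]

/-- Core set-up alone inhabits the D-free part. -/
theorem nonempty_core_of_setup (P : C4a.PointedCore C) (hinv : Invariance C) (hsc : ScalarClosed C) (h1 : OmgOne C) :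
    Nonempty (ArchCCore C P) :=
  ⟨ArchCCore.junk P hinv hsc h1⟩

/-- **(3) UPPER BOUND**: three elementary D-free core facts and the STRONG occurrence statement give the S4
binder.  Together with `occLeaf_of_nonempty` / `invariance_of_nonempty` / `nonempty_core_of_nonempty`:
  `Invariance ∧ ScalarClosed ∧ OmgOne ∧ StrongOcc ⟹ Nonempty (ArchCDatum C D P) ⟹ Invariance ∧ Nonempty (ArchCCore C P) ∧ OccLeaf`. -/
theorem nonempty_of_strongOcc {D : TorusData C} (P : C4a.PointedCore C) (hinv : Invariance C) (hsc : ScalarClosed C) (h1 : OmgOne C)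
    (hocc : StrongOcc C D) : Nonempty (ArchCDatum C D P) :=
  nonempty_of_core_of_strongOcc (ArchCCore.junk P hinv hsc h1) hocc

/-- … and what that junk datum "proves" through the landed N29 theorem is the leaf, from the strong statement
(which of course implies it directly, `occLeaf_of_strongOcc`): the cone cannot see that the torus was trivial. -/
theorem junk_H_occ {D : TorusData C} (P : C4a.PointedCore C) (hinv : Invariance C) (hsc : ScalarClosed C) (h1 : OmgOne C)
    (hocc : StrongOcc C D) : OccLeaf C D :=
  ((ArchCCore.junk P hinv hsc h1).toDatum D fun _ he => hocc _
    ((ArchCCore.junk P hinv hsc h1).ne_bot_of_eigen he)).H_occ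

end Junk

/-! ## (2) GENUINE EXTRA STRENGTH: the one-point model of the Prior programme

`SmokeS4.core` (HodgeCM/Prior/Perl34.lean, § SmokeS4): `H = HG = CG = ℂ`, `G = SK = SigIdx = SigIdxG = Unit`,
`R` trivial, `ω = id`, `𝒯_Φ = id`, `σ̂ = ⊤`; `SmokeS4.torus`: `wOccurs ≡ True`; `SmokeS4.pointed`: `Pt = Unit`,
`eval = id`.  The leaf and N21 hold there, `ScalarClosed` fails (no Φ' with `𝒯_{Φ'} = 0`), and the S4 record
is EMPTY over this core for every torus side and every pointed extension. -/

section Smoke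

open SmokeS4 in
/-- The leaf holds on the one-point model (its `wOccurs` is `True`). -/
theorem occLeaf_smoke : OccLeaf core torus := fun _ _ _ => trivial

open SmokeS4 in
/-- Even the strong occurrence statement holds on the one-point model. -/
theorem strongOcc_smoke : StrongOcc core torus := fun _ _ => trivial

open SmokeS4 in
/-- N21 holds on the one-point model (`R` trivial, `ω = id`). -/
theorem invariance_smoke : Invariance core := by
  intro h Φ v
  show (ContinuousLinearMap.id ℂ ℂ) (((1 : Unit →* (ℂ →L[ℂ] ℂ)) h) v) = (ContinuousLinearMap.id ℂ ℂ) v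
  rw [MonoidHom.one_apply, one_apply_eq_self]

open SmokeS4 in
/-- ω(1) = id holds on the one-point model. -/
theorem omgOne_smoke : OmgOne core := fun _ => rfl

open SmokeS4 in
/-- `ScalarClosed` FAILS on the one-point model: `𝒯 ≡ id` has no scalar multiple `0` in its range. -/
theorem not_scalarClosed_smoke : ¬ ScalarClosed core := by
  intro h
  obtain ⟨Φ', hΦ'⟩ := h 0 ()
  have h1 := congrArg (fun T : ℂ →L[ℂ] ℂ => T 1) hΦ'
  change (ContinuousLinearMap.id ℂ ℂ) (1 : ℂ) = ((0 : ℂ) • ContinuousLinearMap.id ℂ ℂ) (1 : ℂ) at h1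
  simp at h1

open SmokeS4 in
/-- **No D-free chart exists over the one-point core**, whatever the pointed extension: `pure_detect` produces a
pure tensor `ins f φ` (𝒯 = id detects `v = 1` at some point, points separating), and `ins_smul` at `c = 0` then
demands `𝒯_{ins f 0} = 0`, but every `𝒯_Φ` is `id`. -/
theorem isEmpty_archCCore_smoke (P : C4a.PointedCore core) : IsEmpty (ArchCCore core P) := by
  refine ⟨fun K => ?_⟩
  have hT : core.TΦc () (1 : ℂ) ≠ 0 := by
    show (ContinuousLinearMap.id ℂ ℂ) (1 : ℂ) ≠ 0
    rw [ContinuousLinearMap.coe_id', id_eq]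
    exact one_ne_zero
  obtain ⟨p, hp⟩ := C4a.exists_evalPt_ne_zero core P hT
  obtain ⟨f, φ, -⟩ := K.pure_detect () p 1 hp
  have h0 := K.ins_smul f 0 φ
  rw [zero_smul, zero_smul] at h0
  have h1 := congrArg (fun T : ℂ →L[ℂ] ℂ => T 1) h0
  change (ContinuousLinearMap.id ℂ ℂ) (1 : ℂ) = (0 : ℂ →L[ℂ] ℂ) 1 at h1
  simp at h1

open SmokeS4 in
/-- **GENUINE EXTRA STRENGTH of the S4 binder**: over the one-point core the S4 record is empty for EVERY torus
side `D` and EVERY pointed extension `P` — although `OccLeaf core torus`, `StrongOcc core torus` and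
`Invariance core` all hold.  Hence no theorem `Nonempty (ArchCDatum C D P) ↔ OccLeaf C D` (nor `↔ StrongOcc`,
nor `↔ OccLeaf ∧ Invariance`) holds without hypotheses on the core: the binder is not conservative over the
open input `Open_occ`. -/
theorem isEmpty_archCDatum_smoke (D : TorusData core) (P : C4a.PointedCore core) :
    IsEmpty (ArchCDatum core D P) :=
  ⟨fun A => (isEmpty_archCCore_smoke P).false A.toCore⟩

open SmokeS4 in
/-- The separating instance in one line: leaf TRUE, binder FALSE (on the model's own torus side and pointed
extension). -/
theorem leaf_true_binder_false_smoke :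
    OccLeaf core torus ∧ Invariance core ∧ ¬ Nonempty (ArchCDatum core torus pointed) :=
  ⟨occLeaf_smoke, invariance_smoke, fun ⟨A⟩ => (isEmpty_archCDatum_smoke torus pointed).false A⟩

end Smoke

end PerL34.ArchC

/-! ## (5) Model level: the binder shapes of `Open_occ_of_archC` -/

namespace Universe.ThetaModel

open HodgeCM.Prior.Perl34File HodgeCM.Prior.Perl34File.Perl34 HodgeCM.PerL34.ArchC

variable {U : Universe} (T : U.ThetaModel)

/-- The `Pc` binder of `Open_occ_of_archC` is always available (Hahn–Banach points). -/
def pointedCores {L : CMField} {ι₁ : L →+* ℂ} (V : HermSpace3 L ι₁) (c : SeesawCtx L) :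
    C4a.PointedCore (T.core V c) :=
  PointedCore.ofDual (T.core V c)

/-- The `A12`/`A34` binder for a torus-side selector `Dsel` (`T.t12` or `T.t34`), SPLIT: per good context, a
D-free chart whose eigen components have `wOccurs`. -/
theorem archC_binder_iff_core
    (Pc : ∀ {L : CMField} {ι₁ : L →+* ℂ} (V : HermSpace3 L ι₁) (c : SeesawCtx L),
      C4a.PointedCore (T.core V c))
    (Dsel : ∀ {L : CMField} {ι₁ : L →+* ℂ} (V : HermSpace3 L ι₁) (c : SeesawCtx L),
      TorusData (T.core V c)) :
    (∀ {L : CMField} {ι₁ : L →+* ℂ} (V : HermSpace3 L ι₁) (c : SeesawCtx L),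
        T.GoodCtx ι₁ c → Nonempty (ArchCDatum (T.core V c) (Dsel V c) (Pc V c))) ↔
      (∀ {L : CMField} {ι₁ : L →+* ℂ} (V : HermSpace3 L ι₁) (c : SeesawCtx L),
        T.GoodCtx ι₁ c → ∃ K : ArchCCore (T.core V c) (Pc V c), ∀ i, K.Eigen i → (Dsel V c).wOccurs i) := by
  constructor
  · intro h L ι₁ V c hc
    exact nonempty_iff_core.mp (h V c hc)
  · intro h L ι₁ V c hc
    exact nonempty_iff_core.mpr (h V c hc)

/-- UPPER BOUND at binder level: D-free charts (core set-up; e.g. `ArchCCore.junk` from N21 + `ScalarClosed` +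
`OmgOne`, or pv12-g3's honest Fock bridge) plus the STRONG occurrence statement on the selected torus side give
the `A12`/`A34` binder. -/
theorem archC_binder_of_strongOcc
    (Pc : ∀ {L : CMField} {ι₁ : L →+* ℂ} (V : HermSpace3 L ι₁) (c : SeesawCtx L),
      C4a.PointedCore (T.core V c))
    (Dsel : ∀ {L : CMField} {ι₁ : L →+* ℂ} (V : HermSpace3 L ι₁) (c : SeesawCtx L),
      TorusData (T.core V c))
    (K : ∀ {L : CMField} {ι₁ : L →+* ℂ} (V : HermSpace3 L ι₁) (c : SeesawCtx L),
      T.GoodCtx ι₁ c → Nonempty (ArchCCore (T.core V c) (Pc V c)))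
    (hocc : ∀ {L : CMField} {ι₁ : L →+* ℂ} (V : HermSpace3 L ι₁) (c : SeesawCtx L),
      T.GoodCtx ι₁ c → StrongOcc (T.core V c) (Dsel V c)) :
    ∀ {L : CMField} {ι₁ : L →+* ℂ} (V : HermSpace3 L ι₁) (c : SeesawCtx L),
      T.GoodCtx ι₁ c → Nonempty (ArchCDatum (T.core V c) (Dsel V c) (Pc V c)) := by
  intro L ι₁ V c hc
  obtain ⟨K⟩ := K V c hc
  exact nonempty_of_core_of_strongOcc K (hocc V c hc)

/-- LOWER BOUND at binder level, beyond `Open_occ_of_archC`: the binder pins N21 in every good context. -/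
theorem invariance_of_archC_binder
    (Pc : ∀ {L : CMField} {ι₁ : L →+* ℂ} (V : HermSpace3 L ι₁) (c : SeesawCtx L),
      C4a.PointedCore (T.core V c))
    (Dsel : ∀ {L : CMField} {ι₁ : L →+* ℂ} (V : HermSpace3 L ι₁) (c : SeesawCtx L),
      TorusData (T.core V c))
    (A : ∀ {L : CMField} {ι₁ : L →+* ℂ} (V : HermSpace3 L ι₁) (c : SeesawCtx L),
      T.GoodCtx ι₁ c → Nonempty (ArchCDatum (T.core V c) (Dsel V c) (Pc V c))) :
    ∀ {L : CMField} {ι₁ : L →+* ℂ} (V : HermSpace3 L ι₁) (c : SeesawCtx L),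
      T.GoodCtx ι₁ c → Invariance (T.core V c) :=
  fun V c hc => invariance_of_nonempty (A V c hc)

/-- `Open_occ` from core set-up and the STRONG occurrence statement on both torus sides, THROUGH the landed
`Open_occ_of_archC` with junk charts and Hahn–Banach points — the S4 analogue of
`SeamVacuity.clusterOutputs_of_open_chars`: what the cone certifies beyond `Open_occ` is core set-up, not the
torus dictionary. -/
theorem open_occ_of_strongOcc
    (hinv : ∀ {L : CMField} {ι₁ : L →+* ℂ} (V : HermSpace3 L ι₁) (c : SeesawCtx L),
      T.GoodCtx ι₁ c → Invariance (T.core V c))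
    (hsc : ∀ {L : CMField} {ι₁ : L →+* ℂ} (V : HermSpace3 L ι₁) (c : SeesawCtx L),
      T.GoodCtx ι₁ c → ScalarClosed (T.core V c))
    (h1 : ∀ {L : CMField} {ι₁ : L →+* ℂ} (V : HermSpace3 L ι₁) (c : SeesawCtx L),
      T.GoodCtx ι₁ c → OmgOne (T.core V c))
    (h12 : ∀ {L : CMField} {ι₁ : L →+* ℂ} (V : HermSpace3 L ι₁) (c : SeesawCtx L),
      T.GoodCtx ι₁ c → StrongOcc (T.core V c) (T.t12 V c))
    (h34 : ∀ {L : CMField} {ι₁ : L →+* ℂ} (V : HermSpace3 L ι₁) (c : SeesawCtx L),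
      T.GoodCtx ι₁ c → StrongOcc (T.core V c) (T.t34 V c)) :
    T.Open_occ :=
  Open_occ_of_archC T (fun V c => T.pointedCores V c)
    (fun V c hc => nonempty_of_strongOcc _ (hinv V c hc) (hsc V c hc) (h1 V c hc) (h12 V c hc))
    (fun V c hc => nonempty_of_strongOcc _ (hinv V c hc) (hsc V c hc) (h1 V c hc) (h34 V c hc))

end Universe.ThetaModel

end HodgeCM

end
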